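import Literature.Probability.RandomPlanarGeometry.SAWTriangularBridgeSurgery
import HarnessLib

/-!
# Half-space walks of the triangular lattice in the list model, and the detour surgery restricted to them

Topic `Literature/Probability/RandomPlanarGeometry` (lane «pcv-sawmu», item «TRI-HALFSPACE-RATIO»:
`h_{N+1}(𝕋)/h_N(𝕋) → μ(𝕋)`; continues `SAWTriangularBridgeSurgery.lean`: `triHgt`, the heights after `triIns`/`triDel`,
and `SAWTriangularBridges.lean`: `brickHalfSpaceWalks`, `brickHalfSpaceCount = h_N(𝕋)`). Sources: N. Madras, G. Slade,
*The Self-Avoiding Walk* (1993), Definition 3.1.2 (half-space walks: `ω₁(0) < ω₁(i)` for `i ≥ 1`), §7.3, proof of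
Theorem 7.3.2 (the transfer `(ω, site) ↦ (ω', site)` counted in two ways, (7.3.5)–(7.3.7)); the one-step ratio
limit for half-space walks on `ℤ^d` is Lawler–Schramm–Werner 2004, Appendix A, (A.3)
[cite: LawlerSchrammWerner2004SAW, Appendix A, (A.3)] (tree: `Zd.LawlerSchrammWerner2004_eqA3`); for `𝕋` we have
not located it in print.  On `𝕋` the one-step detour surgery of `SAWTriangularDetourSurgery.lean` acts on
half-space walks directly: deleting the apex of a sharp turn keeps every remaining height, inserting an apex keeps a
half-space walk iff the apex lies above the base level — this file is the word-for-word sibling of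
`SAWTriangularBridgeSurgery.lean` with the bridge window `(X(ω₀), X(ω_N)]` replaced by the half-space window
`(X(ω₀), ∞)`.

## Contents (namespace `Literature.Probability.RandomPlanarGeometry.SAW`)

* `IsTriHalfSpaceList N ω` (`X(ω₀) < X(ω_i)`, `1 ≤ i ≤ N`), **`triHL N`** = the `N`-step half-space walks of `𝕋` as
  vertex lists, `card_triHL : #(triHL N) = brickHalfSpaceCount N`;
* `triHSlots ω` — the detour slots `(m, z)` whose apex height exceeds `X(ω₀)`;
* surgery laws `triIns_mem_triHL`, `triDel_mem_triHL`, `mem_triHSlots_triDel`, the pair bijection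
  **`sum_triHSlotPairs_eq_sum_triSharpHPairs`**, `sum_triHSlotPairs`, `sum_triSharpHPairs`;
* bookkeeping `card_triHSlots_le` (`≤ 2N`), `one_le_card_triSharp_triIns_of_triHL`, `card_triHSlots_le_triIns`
  (`I_H(ω) ≤ I_H(ω') + 8`);
* `brickHalfSpaceCount_le_succ : h_N(𝕋) ≤ h_{N+1}(𝕋)` (prepend the brick step `(2,0)`).
-/

noncomputable section

open Finset Function Literature.Probability.LatticeModels Literature.Probability.Percolation SimpleGraph
open scoped BigOperators

namespace Literature.Probability.RandomPlanarGeometry.SAW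

/-! ### Half-space walks of `𝕋` as vertex lists -/

/-- **Half-space walk** (as a vertex list of `𝕋`, brick height): `X(ω₀) < X(ω_i)` for `1 ≤ i ≤ N`.
[cite: MadrasSlade1993, Definition 3.1.2] -/
def IsTriHalfSpaceList (N : ℕ) (ω : List (Site 2)) : Prop :=
  ∀ i ∈ Finset.Icc 1 N, triHgt ω 0 < triHgt ω i

/-- The half-space predicate is decidable. [cite: MadrasSlade1993, Definition 3.1.2] -/
instance (N : ℕ) : DecidablePred (IsTriHalfSpaceList N) := fun _ => by
  unfold IsTriHalfSpaceList; infer_instance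

/-- **`H_N(𝕋)`**: the `N`-step half-space walks of the triangular lattice from `0`, as vertex lists.
[cite: MadrasSlade1993, Definition 3.1.2] -/
def triHL (N : ℕ) : Finset (List (Site 2)) := (triSL N).filter (IsTriHalfSpaceList N)

variable {N : ℕ} {ω : List (Site 2)} {m j : ℕ} {z : Site 2}

/-- Membership in `triHL`. [cite: MadrasSlade1993, Definition 3.1.2] -/
theorem mem_triHL : ω ∈ triHL N ↔ ω ∈ triSL N ∧ IsTriHalfSpaceList N ω := Finset.mem_filter

/-- A half-space walk is a self-avoiding walk. [cite: MadrasSlade1993, Definition 3.1.2] -/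
theorem triSL_of_mem_triHL (h : ω ∈ triHL N) : ω ∈ triSL N := (mem_triHL.1 h).1

/-- The half-space inequality, unfolded. [cite: MadrasSlade1993, Definition 3.1.2] -/
theorem hgt_of_mem_triHL (h : ω ∈ triHL N) {i : ℕ} (h1 : 1 ≤ i) (h2 : i ≤ N) : triHgt ω 0 < triHgt ω i :=
  (mem_triHL.1 h).2 i (Finset.mem_Icc.2 ⟨h1, h2⟩)

/-- The vertex function of a list is a half-space walk (tree predicate `Zd.IsHalfSpace`) iff the list is.
[cite: MadrasSlade1993, Definition 3.1.2] -/
theorem isHalfSpace_brickFun_iff (N : ℕ) (l : List (Site 2)) :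
    Zd.IsHalfSpace N (brickFun N l) ↔ IsTriHalfSpaceList N l := by
  constructor
  · intro h i hi
    rw [Finset.mem_Icc] at hi
    have := h i hi.1 hi.2
    rwa [brickFun_apply_zero, brickFun_apply_zero, Nat.zero_min, min_eq_left hi.2] at this
  · intro h i h1 h2
    have := h i (Finset.mem_Icc.2 ⟨h1, h2⟩)
    rwa [brickFun_apply_zero, brickFun_apply_zero, Nat.zero_min, min_eq_left h2]

open Classical in
/-- The vertex-function half-space walks are the images of the list ones. [cite: MadrasSlade1993, Definition 3.1.2] -/
theorem brickHalfSpaceWalks_eq_image (N : ℕ) : brickHalfSpaceWalks N = (triHL N).image (brickFun N) := by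
  classical
  ext f
  rw [mem_brickHalfSpaceWalks, brickSaws, Finset.mem_image, Finset.mem_image]
  constructor
  · rintro ⟨⟨l, hl, rfl⟩, hb⟩
    exact ⟨l, mem_triHL.2 ⟨hl, (isHalfSpace_brickFun_iff N l).1 hb⟩, rfl⟩
  · rintro ⟨l, hl, rfl⟩
    obtain ⟨hl, hb⟩ := mem_triHL.1 hl
    exact ⟨⟨l, hl, rfl⟩, (isHalfSpace_brickFun_iff N l).2 hb⟩

/-- **`#H_N(𝕋) = h_N(𝕋)`** (the count `brickHalfSpaceCount` of `SAWTriangularBridges.lean`).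
[cite: MadrasSlade1993, Definition 3.1.2] -/
theorem card_triHL (N : ℕ) : #(triHL N) = brickHalfSpaceCount N := by
  classical
  rw [brickHalfSpaceCount, brickHalfSpaceWalks_eq_image, Finset.card_image_of_injOn]
  exact (brickFun_injOn N).mono (by intro l hl; exact Finset.mem_coe.2 (triSL_of_mem_triHL (Finset.mem_coe.1 hl)))

/-- `1 ≤ h_N(𝕋)` (bridges are half-space walks). [cite: MadrasSlade1993, §3.1] -/
theorem one_le_brickHalfSpaceCount (N : ℕ) : 1 ≤ brickHalfSpaceCount N :=
  (one_le_brickBridgeCount N).trans (Finset.card_le_card (brickBridges_subset_brickHalfSpaceWalks N))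

/-- `1 ≤ #H_N(𝕋)`, list form. [cite: MadrasSlade1993, §3.1] -/
theorem one_le_card_triHL (N : ℕ) : 1 ≤ #(triHL N) := by
  rw [card_triHL]; exact one_le_brickHalfSpaceCount N

/-! ### The slots that keep a half-space walk a half-space walk -/

/-- The **half-space slots** of `ω`: detour slots `(m, z)` whose apex height exceeds `X(ω₀)`.
[cite: MadrasSlade1993, §7.3 (proof of Theorem 7.3.2)] -/
def triHSlots (ω : List (Site 2)) : Finset (ℕ × Site 2) :=
  (triSlots ω).filter fun p => triHgt ω 0 < 2 * p.2 0 + p.2 1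

/-- Membership in `triHSlots`. [cite: MadrasSlade1993, §7.3] -/
theorem mem_triHSlots {p : ℕ × Site 2} : p ∈ triHSlots ω ↔ p ∈ triSlots ω ∧ triHgt ω 0 < 2 * p.2 0 + p.2 1 := by
  rw [triHSlots, mem_filter]

/-- Half-space slots are slots. [cite: MadrasSlade1993, §7.3] -/
theorem triHSlots_subset (ω : List (Site 2)) : triHSlots ω ⊆ triSlots ω := filter_subset _ _

/-- `I_H(ω) ≤ I(ω) ≤ 2N`. [cite: MadrasSlade1993, §7.3 (proof of Theorem 7.3.2)] -/
theorem card_triHSlots_le (hω : ω ∈ triHL N) : #(triHSlots ω) ≤ 2 * N :=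
  (card_le_card (triHSlots_subset ω)).trans (card_triSlots_le (triSL_of_mem_triHL hω))

/-! ### The surgery maps `H_N`-slots to `H_{N+1}`-sharp turns and back -/

/-- Inserting an apex above the base level into a half-space walk gives a half-space walk.
[cite: MadrasSlade1993, §7.3 (proof of Theorem 7.3.2)] -/
theorem triIns_mem_triHL (hω : ω ∈ triHL N) (hs : (m, z) ∈ triHSlots ω) : triIns m z ω ∈ triHL (N + 1) := by
  obtain ⟨hs, hlo⟩ := mem_triHSlots.1 hs
  obtain ⟨hm, -, -, -⟩ := mem_triSlots.1 hs
  have hωS := triSL_of_mem_triHL hω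
  have hl := length_of_mem_triSL hωS
  dsimp only at hlo
  refine mem_triHL.2 ⟨triIns_mem_triSL hωS hs, fun i hi => ?_⟩
  rw [Finset.mem_Icc] at hi
  rw [triHgt_triIns_of_le (Nat.zero_le m)]
  rcases Nat.lt_trichotomy i (m + 1) with hlt | heq | hgt
  · rw [triHgt_triIns_of_le (by omega)]
    exact hgt_of_mem_triHL hω hi.1 (by omega)
  · rw [heq, triHgt_triIns_self (by omega)]
    exact hlo
  · rw [triHgt_triIns_of_lt hgt]
    exact hgt_of_mem_triHL hω (by omega) (by omega)

/-- Deleting the apex of a sharp turn of a half-space walk gives a half-space walk (an interior vertex is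
removed; the base vertex stays). [cite: MadrasSlade1993, §7.3 (proof of Theorem 7.3.2)] -/
theorem triDel_mem_triHL (hω : ω ∈ triHL (N + 1)) (hm : m ∈ triSharp ω) : triDel m ω ∈ triHL N := by
  obtain ⟨hml, -⟩ := mem_triSharp.1 hm
  have hωS := triSL_of_mem_triHL hω
  have hl := length_of_mem_triSL hωS
  refine mem_triHL.2 ⟨triDel_mem_triSL hωS hm, fun i hi => ?_⟩
  rw [Finset.mem_Icc] at hi
  rw [triHgt_triDel_of_le (Nat.zero_le m)]
  rcases le_or_gt i m with hle | hgt
  · rw [triHgt_triDel_of_le hle]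
    exact hgt_of_mem_triHL hω hi.1 (by omega)
  · rw [triHgt_triDel_of_lt hgt]
    exact hgt_of_mem_triHL hω (by omega) (by omega)

/-- After the deletion, the deleted apex is a half-space slot of the contracted walk.
[cite: MadrasSlade1993, §7.3 (proof of Theorem 7.3.2)] -/
theorem mem_triHSlots_triDel (hω : ω ∈ triHL (N + 1)) (hm : m ∈ triSharp ω) :
    (m, ω.getD (m + 1) 0) ∈ triHSlots (triDel m ω) := by
  obtain ⟨hml, -⟩ := mem_triSharp.1 hm
  have hωS := triSL_of_mem_triHL hω
  have hl := length_of_mem_triSL hωS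
  have hr := hgt_of_mem_triHL hω (show 1 ≤ m + 1 by omega) (show m + 1 ≤ N + 1 by omega)
  refine mem_triHSlots.2 ⟨mem_triSlots_triDel hωS hm, ?_⟩
  show triHgt (triDel m ω) 0 < triHgt ω (m + 1)
  rw [triHgt_triDel_of_le (Nat.zero_le m)]
  exact hr

/-! ### Counting the half-space pairs in two ways -/

/-- The half-space slot pairs `(ω, (m, z))`, `ω ∈ H_N`, `(m, z)` a half-space slot of `ω`.
[cite: MadrasSlade1993, §7.3 (proof of Theorem 7.3.2), (7.3.5)] -/
def triHSlotPairs (N : ℕ) : Finset (Σ _ : List (Site 2), ℕ × Site 2) := (triHL N).sigma fun ω => triHSlots ω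

/-- The half-space sharp-turn pairs `(ω, m)`, `ω ∈ H_N`, `m` a sharp turn of `ω`.
[cite: MadrasSlade1993, §7.3 (proof of Theorem 7.3.2), (7.3.5)] -/
def triSharpHPairs (N : ℕ) : Finset (Σ _ : List (Site 2), ℕ) := (triHL N).sigma fun ω => triSharp ω

/-- Summing over half-space slot pairs is summing `I_H(ω) · F(ω)` over half-space walks.
[cite: MadrasSlade1993, §7.3] -/
theorem sum_triHSlotPairs (N : ℕ) (F : List (Site 2) → ℝ) :
    ∑ p ∈ triHSlotPairs N, F p.1 = ∑ ω ∈ triHL N, (#(triHSlots ω) : ℝ) * F ω := by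
  rw [triHSlotPairs, Finset.sum_sigma]
  refine sum_congr rfl fun ω _ => ?_
  change ∑ s ∈ triHSlots ω, F ω = _
  rw [sum_const, nsmul_eq_mul]

/-- Summing over half-space sharp-turn pairs is summing `J(ω) · F(ω)` over half-space walks.
[cite: MadrasSlade1993, §7.3] -/
theorem sum_triSharpHPairs (N : ℕ) (F : List (Site 2) → ℝ) :
    ∑ q ∈ triSharpHPairs N, F q.1 = ∑ ω ∈ triHL N, (#(triSharp ω) : ℝ) * F ω := by
  rw [triSharpHPairs, Finset.sum_sigma]
  refine sum_congr rfl fun ω _ => ?_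
  change ∑ s ∈ triSharp ω, F ω = _
  rw [sum_const, nsmul_eq_mul]

/-- **Counting the half-space pairs in two ways**: `(ω, (m, z)) ↦ (triIns m z ω, m)` is a bijection from the
half-space slot pairs of `H_N` onto the sharp-turn pairs of `H_{N+1}` (inverse `(ω', m) ↦ (triDel m ω', (m, ω'_{m+1}))`).
[cite: MadrasSlade1993, §7.3 (proof of Theorem 7.3.2), (7.3.5)–(7.3.6)] -/
theorem sum_triHSlotPairs_eq_sum_triSharpHPairs (N : ℕ) (F : (Σ _ : List (Site 2), ℕ × Site 2) → ℝ)
    (G : (Σ _ : List (Site 2), ℕ) → ℝ)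
    (h : ∀ p ∈ triHSlotPairs N, F p = G ⟨triIns p.2.1 p.2.2 p.1, p.2.1⟩) :
    ∑ p ∈ triHSlotPairs N, F p = ∑ q ∈ triSharpHPairs (N + 1), G q := by
  refine Finset.sum_nbij' (fun p => ⟨triIns p.2.1 p.2.2 p.1, p.2.1⟩)
    (fun q => ⟨triDel q.2 q.1, (q.2, q.1.getD (q.2 + 1) 0)⟩) ?_ ?_ ?_ ?_ h
  · rintro ⟨ω, m, z⟩ hp
    rw [triHSlotPairs, Finset.mem_sigma] at hp
    rw [triSharpHPairs, Finset.mem_sigma]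
    exact ⟨triIns_mem_triHL hp.1 hp.2,
      mem_triSharp_triIns (triSL_of_mem_triHL hp.1) (triHSlots_subset _ hp.2)⟩
  · rintro ⟨ω, m⟩ hq
    rw [triSharpHPairs, Finset.mem_sigma] at hq
    rw [triHSlotPairs, Finset.mem_sigma]
    exact ⟨triDel_mem_triHL hq.1 hq.2, mem_triHSlots_triDel hq.1 hq.2⟩
  · rintro ⟨ω, m, z⟩ hp
    rw [triHSlotPairs, Finset.mem_sigma] at hp
    dsimp only at hp
    obtain ⟨hm, -, -, -⟩ := mem_triSlots.1 (triHSlots_subset _ hp.2)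
    dsimp only
    rw [triDel_triIns, getD_triIns_self (by omega)]
  · rintro ⟨ω, m⟩ hq
    rw [triSharpHPairs, Finset.mem_sigma] at hq
    dsimp only at hq
    obtain ⟨hml, -⟩ := mem_triSharp.1 hq.2
    dsimp only
    rw [triIns_triDel (by omega)]

/-! ### Bookkeeping for half-space walks -/

/-- After an admissible insertion the new walk has a sharp turn: `1 ≤ J(ω')`. [cite: MadrasSlade1993, §7.3] -/
theorem one_le_card_triSharp_triIns_of_triHL (hω : ω ∈ triHL N) (hs : (m, z) ∈ triHSlots ω) :
    1 ≤ #(triSharp (triIns m z ω)) :=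
  one_le_card_triSharp_triIns (triSL_of_mem_triHL hω) (triHSlots_subset _ hs)

/-- **`I_H(ω) ≤ I_H(ω') + 8`**: a half-space slot `(j, u)` of `ω` with `j ≠ m`, `u ≠ z` is (shifted) a half-space
slot of `ω' = triIns m z ω` (same apex height, same base level); the others number at most `2 + 6`.
[cite: MadrasSlade1993, §7.3 (proof of Theorem 7.3.2)] -/
theorem card_triHSlots_le_triIns (hω : ω ∈ triHL N) (hs : (m, z) ∈ triHSlots ω) :
    #(triHSlots ω) ≤ #(triHSlots (triIns m z ω)) + 8 := by
  have hωS := triSL_of_mem_triHL hω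
  have hs' := triHSlots_subset _ hs
  obtain ⟨hm, -, -, -⟩ := mem_triSlots.1 hs'
  have hl := length_of_mem_triSL hωS
  -- the base level is unchanged by the insertion
  have hbot : triHgt (triIns m z ω) 0 = triHgt ω 0 := triHgt_triIns_of_le (Nat.zero_le m)
  have hsplit := card_filter_add_card_filter_not (s := triHSlots ω)
    (p := fun p : ℕ × Site 2 => p.1 ≠ m ∧ p.2 ≠ z)
  have hA : #((triHSlots ω).filter fun p : ℕ × Site 2 => p.1 ≠ m ∧ p.2 ≠ z) ≤ #(triHSlots (triIns m z ω)) := by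
    refine card_le_card_of_injOn (fun p : ℕ × Site 2 => if p.1 < m then p else (p.1 + 1, p.2)) ?_ ?_
    · rintro ⟨j, u⟩ hp
      rw [mem_coe, mem_filter] at hp
      obtain ⟨hp, hjm, huz⟩ := hp
      obtain ⟨hp, hr1⟩ := mem_triHSlots.1 hp
      obtain ⟨hj, hp1, hp2, hp3⟩ := mem_triSlots.1 hp
      dsimp only at hjm huz hr1 ⊢
      have hu' : u ∉ triIns m z ω := by
        rw [mem_triIns (by omega)]
        push Not
        exact ⟨huz, hp3⟩
      rw [mem_coe, mem_triHSlots, hbot]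
      split_ifs with hlt
      · refine ⟨mem_triSlots.2 ⟨by rw [length_triIns (by omega)]; omega, ?_, ?_, hu'⟩, hr1⟩
        · rw [getD_triIns_of_le hlt.le]; exact hp1
        · rw [getD_triIns_of_le (by omega)]; exact hp2
      · have hgt : m < j := lt_of_le_of_ne (not_lt.1 hlt) (Ne.symm hjm)
        refine ⟨mem_triSlots.2 ⟨by rw [length_triIns (by omega)]; omega, ?_, ?_, hu'⟩, hr1⟩
        · rw [getD_triIns_of_lt (by omega), Nat.add_sub_cancel]; exact hp1
        · rw [getD_triIns_of_lt (by omega), show j + 1 + 1 - 1 = j + 1 by omega]; exact hp2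
    · rintro ⟨j₁, u₁⟩ hp₁ ⟨j₂, u₂⟩ hp₂ he
      rw [mem_coe, mem_filter] at hp₁ hp₂
      dsimp only at he hp₁ hp₂
      split_ifs at he with ha hb hb
      · exact he
      · rw [Prod.mk.injEq] at he; omega
      · rw [Prod.mk.injEq] at he; omega
      · rw [Prod.mk.injEq] at he ⊢; exact ⟨by omega, he.2⟩
  have hB : #((triHSlots ω).filter fun p : ℕ × Site 2 => ¬(p.1 ≠ m ∧ p.2 ≠ z)) ≤ 8 := by
    have hsub : ((triHSlots ω).filter fun p : ℕ × Site 2 => ¬(p.1 ≠ m ∧ p.2 ≠ z)) ⊆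
        ((triSlots ω).filter fun p : ℕ × Site 2 => p.1 = m) ∪
          ((triSlots ω).filter fun p : ℕ × Site 2 => p.2 = z) := by
      intro p hp
      rw [mem_filter] at hp
      have hpS := triHSlots_subset _ hp.1
      rw [mem_union, mem_filter, mem_filter]
      by_cases hpm : p.1 = m
      · exact Or.inl ⟨hpS, hpm⟩
      · exact Or.inr ⟨hpS, by_contra fun h' => hp.2 ⟨hpm, h'⟩⟩
    have hE : #((triSlots ω).filter fun p : ℕ × Site 2 => p.1 = m) ≤ 2 := by
      calc _ ≤ #(((triGraph.neighborFinset (ω.getD m 0)).filter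
              fun u => triGraph.Adj u (ω.getD (m + 1) 0)).image (Prod.mk m)) := by
            refine card_le_card fun p hp => ?_
            obtain ⟨j, u⟩ := p
            rw [mem_filter] at hp
            obtain ⟨hp, hjm⟩ := hp
            dsimp only at hjm
            subst hjm
            obtain ⟨-, hp1, hp2, -⟩ := mem_triSlots.1 hp
            exact mem_image.2 ⟨u, mem_filter.2 ⟨(SimpleGraph.mem_neighborFinset _ _ _).2 hp1, hp2⟩, rfl⟩
        _ ≤ _ := card_image_le
        _ ≤ 2 := card_apex_le_two (adj_getD_of_mem_triSL hωS (by omega))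
    have hR : #((triSlots ω).filter fun p : ℕ × Site 2 => p.2 = z) ≤ 6 := by
      calc _ ≤ #(triGraph.neighborFinset z) := by
            refine card_le_card_of_injOn (fun p : ℕ × Site 2 => ω.getD p.1 0) ?_ ?_
            · rintro ⟨j, u⟩ hp
              rw [mem_coe, mem_filter] at hp
              obtain ⟨hp, huz⟩ := hp
              dsimp only at huz
              subst huz
              obtain ⟨-, hp1, -, -⟩ := mem_triSlots.1 hp
              rw [mem_coe, SimpleGraph.mem_neighborFinset]
              exact hp1.symm
            · rintro ⟨j₁, u₁⟩ hp₁ ⟨j₂, u₂⟩ hp₂ he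
              rw [mem_coe, mem_filter] at hp₁ hp₂
              obtain ⟨hj₁, -, -, -⟩ := mem_triSlots.1 hp₁.1
              obtain ⟨hj₂, -, -, -⟩ := mem_triSlots.1 hp₂.1
              dsimp only at he hp₁ hp₂
              have hj := getD_injOn_of_mem_triSL hωS (by omega) (by omega) he
              rw [Prod.mk.injEq]
              exact ⟨hj, hp₁.2.trans hp₂.2.symm⟩
        _ = 6 := card_neighborFinset_triGraph_holds z
    calc _ ≤ #(((triSlots ω).filter fun p : ℕ × Site 2 => p.1 = m) ∪
              ((triSlots ω).filter fun p : ℕ × Site 2 => p.2 = z)) := card_le_card hsub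
      _ ≤ #((triSlots ω).filter fun p : ℕ × Site 2 => p.1 = m) +
            #((triSlots ω).filter fun p : ℕ × Site 2 => p.2 = z) := card_union_le _ _
      _ ≤ 8 := by omega
  omega

/-! ### `h_N(𝕋) ≤ h_{N+1}(𝕋)` -/

/-- **`h_N(𝕋) ≤ h_{N+1}(𝕋)`**: prepend the brick step `(2, 0)` — the concatenation of the one-step bridge
`i ↦ (2 min(i,1), 0)` with a half-space walk is a half-space walk (all later heights are `≥ 3 > 0`), injectively.
[cite: MadrasSlade1993, §1.2 eq. (1.2.15) and Definition 3.1.2] -/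
theorem brickHalfSpaceCount_le_succ (N : ℕ) : brickHalfSpaceCount N ≤ brickHalfSpaceCount (N + 1) := by
  classical
  rw [brickHalfSpaceCount, brickHalfSpaceCount]
  have h1 := brickStraightWalk_mem_brickSaws 1
  refine Finset.card_le_card_of_injOn (fun υ => Zd.concatWalk 1 (brickStraightWalk 1) υ) ?_ ?_
  · intro υ hυ
    rw [Finset.mem_coe, mem_brickHalfSpaceWalks] at hυ
    obtain ⟨hυs, hυh⟩ := hυ
    have hυ0 : υ 0 = 0 := (mem_brickSaws.1 hυs).1
    have hpos : ∀ j, 1 ≤ j → j ≤ N → 0 < υ j 0 := fun j hj1 hj2 => by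
      have := hυh j hj1 hj2
      rwa [hυ0] at this
    have hsep : ∀ i ≤ 1, ∀ j, 1 ≤ j → j ≤ N → brickStraightWalk 1 i ≠ brickStraightWalk 1 1 + υ j := by
      intro i hi j hj1 hj2 h
      have e := congrArg (fun y : Site 2 => y 0) h
      simp only [Pi.add_apply, brickStraightWalk_apply_zero, min_self, Nat.cast_one] at e
      have := hpos j hj1 hj2
      have hmin : ((min i 1 : ℕ) : ℤ) ≤ 1 := by exact_mod_cast Nat.min_le_right i 1
      linarith
    have hmem := concatWalk_mem_brickSaws h1 hυs hsep
    rw [Nat.add_comm] at hmem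
    rw [Finset.mem_coe, mem_brickHalfSpaceWalks]
    refine ⟨hmem, fun i hi1 hi2 => ?_⟩
    show Zd.concatWalk 1 (brickStraightWalk 1) υ 0 0 < Zd.concatWalk 1 (brickStraightWalk 1) υ i 0
    simp only [Zd.concatWalk, Nat.zero_le, if_true, brickStraightWalk_apply_zero, Nat.zero_min, Nat.cast_zero,
      mul_zero]
    by_cases hi : i ≤ 1
    · rw [if_pos hi, brickStraightWalk_apply_zero, min_eq_left hi]
      have : i = 1 := by omega
      subst this
      norm_num
    · rw [if_neg hi, Pi.add_apply, brickStraightWalk_apply_zero, min_self]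
      have := hpos (i - 1) (by omega) (by omega)
      push_cast
      linarith
  · intro υ hυ υ' hυ' h
    rw [Finset.mem_coe, mem_brickHalfSpaceWalks] at hυ hυ'
    have hυ0 : υ 0 = 0 := (mem_brickSaws.1 hυ.1).1
    have hυ'0 : υ' 0 = 0 := (mem_brickSaws.1 hυ'.1).1
    funext j
    rcases Nat.eq_zero_or_pos j with hj | hj
    · rw [hj, hυ0, hυ'0]
    · have e := congrFun h (j + 1)
      simp only [Zd.concatWalk, show ¬ j + 1 ≤ 1 by omega, if_false, Nat.add_sub_cancel] at e
      exact add_left_cancel e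

/-- `#H_N(𝕋) ≤ #H_{N+1}(𝕋)`, list form. [cite: MadrasSlade1993, Definition 3.1.2] -/
theorem card_triHL_le_succ (N : ℕ) : #(triHL N) ≤ #(triHL (N + 1)) := by
  rw [card_triHL, card_triHL]; exact brickHalfSpaceCount_le_succ N

end Literature.Probability.RandomPlanarGeometry.SAW
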